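import Mathlib
import HarnessLib

/-!
# Route `RoughValueTransport`, crux `RoughValueLaw` (stmt-Parity-11390), line `friable-deep-tail`:
# the registered stub `stub_rieszProductLimit` (S2b₂α)

`--supports` file of the checked skeleton of line `friable-deep-tail` (v7).  It PROVES the
registered stub S2b₂α verbatim — a statement of pure real analysis about arithmetic functions
`a₀, …, a_{k-1} : ℕ → ℝ`: if every order-1 logarithmic Riesz mean
`R⁽¹⁾_{aᵢ}(x) = Σ_{n ≤ x} aᵢ(n)/n · log(x/n)` converges (H1) and every sharp cut-off
`M_{aᵢ}(x) = Σ_{n ≤ x} aᵢ(n)/n` is `O(1/log² x)` (H2), then the order-`k` Riesz mean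
`Σ_{n ≤ x} (a₀ ⋆ ⋯ ⋆ a_{k-1})(n)/n · log(x/n)^k` of the `k`-fold Dirichlet product converges
(only existence is asserted).  Proof: induction on `k`; the step is the identity
`R⁽ᵏ⁺¹⁾_{B⋆α}(x) = (k+1)[L·R⁽¹⁾_α(x) + ∫₀^{log x} M_α(e^v)(R⁽ᵏ⁾_B(x e^{-v}) − L) dv]`
(log-coordinates, finite sum/integral swaps) plus dominated convergence.  Mathlib only.
-/

noncomputable section

open Filter Finset MeasureTheory
open scoped Topology BigOperators

namespace Summit.Parity.BatemanHorn.Cruxes.RoughValueLaw.FriableDeepTail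

namespace RieszProductLimit

/-- A sum over `n ∈ Icc 1 ⌊x⌋₊` of measurable functions of `x` is measurable in `x`. -/
theorem measurable_sum_Icc_floor {F : ℕ → ℝ → ℝ} (hF : ∀ n, Measurable (F n)) :
    Measurable fun x : ℝ => ∑ n ∈ Icc 1 ⌊x⌋₊, F n x := by
  have h : Measurable fun p : ℝ × ℕ => ∑ n ∈ Icc 1 p.2, F n p.1 :=
    measurable_from_prod_countable_left fun N => by
      change Measurable fun x : ℝ => ∑ n ∈ Icc 1 N, F n x
      exact Finset.measurable_fun_sum _ fun n _ => hF n
  exact h.comp (measurable_id.prodMk Nat.measurable_floor)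

/-- A bounded measurable real function is interval integrable. -/
theorem intervalIntegrable_of_abs_le {g : ℝ → ℝ} (hg : Measurable g) {K : ℝ}
    (hK : ∀ v, |g v| ≤ K) (a b : ℝ) : IntervalIntegrable g volume a b :=
  (intervalIntegrable_const (c := K)).mono_fun' hg.aestronglyMeasurable
    (Eventually.of_forall fun v => by simpa [Real.norm_eq_abs] using hK v)

/-- Cutting an interval integral from below by an indicator of `[c, ∞)`. -/
theorem integral_indicator_Ici {a b c : ℝ} (hac : a ≤ c) (hcb : c ≤ b) (g : ℝ → ℝ) :
    ∫ v in a..b, Set.indicator (Set.Ici c) g v = ∫ v in c..b, g v := by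
  rw [intervalIntegral.integral_of_le (hac.trans hcb), intervalIntegral.integral_of_le hcb,
    setIntegral_indicator measurableSet_Ici]
  rcases eq_or_lt_of_le hac with rfl | hac'
  · rw [Set.inter_eq_left.mpr (Set.Ioc_subset_Ioi_self.trans Set.Ioi_subset_Ici_self)]
  · rw [show Set.Ioc a b ∩ Set.Ici c = Set.Icc c b from Set.ext fun v =>
        ⟨fun h => ⟨h.2, h.1.2⟩, fun h => ⟨⟨hac'.trans_le h.1, h.2⟩, h.1⟩⟩,
      integral_Icc_eq_integral_Ioc]

/-- Indicators of `[c, ∞)` preserve interval integrability. -/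
theorem intervalIntegrable_indicator_Ici {g : ℝ → ℝ} {a b : ℝ}
    (hg : IntervalIntegrable g volume a b) (c : ℝ) :
    IntervalIntegrable (Set.indicator (Set.Ici c) g) volume a b :=
  ⟨hg.1.indicator measurableSet_Ici, hg.2.indicator measurableSet_Ici⟩

/-- Cutting a sum over `n ≤ y` at `n ≤ e^u` by the indicators of `log n ≤ u`. -/
theorem sum_indicator_Ici_log {w : ℕ → ℝ} {g : ℕ → ℝ → ℝ} {u y : ℝ} (huy : Real.exp u ≤ y) :
    ∑ n ∈ Icc 1 ⌊y⌋₊, w n * Set.indicator (Set.Ici (Real.log n)) (g n) u =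
      ∑ n ∈ Icc 1 ⌊Real.exp u⌋₊, w n * g n u := by
  rw [← Finset.sum_subset (Finset.Icc_subset_Icc_right (Nat.floor_le_floor huy))]
  · refine Finset.sum_congr rfl fun n hn => ?_
    obtain ⟨hn1, hnu⟩ := mem_Icc.mp hn
    rw [Set.indicator_of_mem (Set.mem_Ici.mpr ((Real.log_le_iff_le_exp (by exact_mod_cast hn1)).mpr
      ((Nat.le_floor_iff (Real.exp_pos u).le).mp hnu)))]
  · intro n hn hn'
    obtain ⟨hn1, _⟩ := mem_Icc.mp hn
    have hnu : Real.exp u < n :=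
      (Nat.floor_lt (Real.exp_pos u).le).mp (by simpa [mem_Icc, hn1] using hn')
    rw [Set.indicator_of_notMem (Set.notMem_Ici.mpr
      ((Real.lt_log_iff_exp_lt (by exact_mod_cast hn1)).mpr hnu)), mul_zero]

/-- **(i)** The order-`j+1` Riesz mean is `(j+1)` times the logarithmic integral of the order-`j`
Riesz mean: `R⁽ʲ⁺¹⁾_c(y) = (j+1) ∫₀^{log y} R⁽ʲ⁾_c(e^u) du` for `y ≥ 1`. -/
theorem riesz_succ_eq_integral (c : ℕ → ℝ) (j : ℕ) {y : ℝ} (hy : 1 ≤ y) :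
    ∑ n ∈ Icc 1 ⌊y⌋₊, c n / n * Real.log (y / n) ^ (j + 1) =
      (j + 1) * ∫ u in (0 : ℝ)..Real.log y,
        ∑ n ∈ Icc 1 ⌊Real.exp u⌋₊, c n / n * Real.log (Real.exp u / n) ^ j := by
  have hy0 : 0 < y := one_pos.trans_le hy
  have hlogy : 0 ≤ Real.log y := Real.log_nonneg hy
  have h1 : ∫ u in (0 : ℝ)..Real.log y,
        ∑ n ∈ Icc 1 ⌊Real.exp u⌋₊, c n / n * Real.log (Real.exp u / n) ^ j =
      ∫ u in (0 : ℝ)..Real.log y, ∑ n ∈ Icc 1 ⌊y⌋₊,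
        c n / n * Set.indicator (Set.Ici (Real.log n)) (fun u => (u - Real.log n) ^ j) u := by
    refine intervalIntegral.integral_congr fun u hu => ?_
    rw [Set.uIcc_of_le hlogy] at hu
    have huy : Real.exp u ≤ y := by
      simpa [Real.exp_log hy0] using Real.exp_le_exp.mpr hu.2
    rw [sum_indicator_Ici_log huy]
    refine Finset.sum_congr rfl fun n hn => ?_
    have hn0 : (0 : ℝ) < n := by exact_mod_cast (mem_Icc.mp hn).1
    rw [Real.log_div (Real.exp_pos u).ne' hn0.ne', Real.log_exp]
  rw [h1, intervalIntegral.integral_finsetSum, Finset.mul_sum]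
  · refine Finset.sum_congr rfl fun n hn => ?_
    obtain ⟨hn1, hny⟩ := mem_Icc.mp hn
    have hn0 : (0 : ℝ) < n := by exact_mod_cast hn1
    rw [intervalIntegral.integral_const_mul, integral_indicator_Ici (Real.log_nonneg
        (by exact_mod_cast hn1)) (Real.log_le_log hn0 ((Nat.le_floor_iff hy0.le).mp hny)),
      intervalIntegral.integral_comp_sub_right (fun u => u ^ j) (Real.log n), sub_self,
      integral_pow, Real.log_div hy0.ne' hn0.ne', zero_pow j.succ_ne_zero, sub_zero]
    field_simp
  · intro n _
    refine (intervalIntegrable_indicator_Ici ?_ _).const_mul _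
    exact Continuous.intervalIntegrable (by fun_prop) _ _

/-- **Swap** of a finite `m`-sum with a logarithmic integral cut at `log m`:
`Σ_{m ≤ x} w(m) ∫_{log m}^{log x} g = ∫₀^{log x} (Σ_{m ≤ e^v} w(m)) g(v) dv` for `x ≥ 1`. -/
theorem sum_mul_integral_log_eq {w : ℕ → ℝ} {g : ℝ → ℝ}
    (hg : ∀ a b, IntervalIntegrable g volume a b) {x : ℝ} (hx : 1 ≤ x) :
    ∑ m ∈ Icc 1 ⌊x⌋₊, w m * ∫ v in Real.log m..Real.log x, g v =
      ∫ v in (0 : ℝ)..Real.log x, (∑ m ∈ Icc 1 ⌊Real.exp v⌋₊, w m) * g v := by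
  have hx0 : 0 < x := one_pos.trans_le hx
  have hlogx : 0 ≤ Real.log x := Real.log_nonneg hx
  calc ∑ m ∈ Icc 1 ⌊x⌋₊, w m * ∫ v in Real.log m..Real.log x, g v
      = ∑ m ∈ Icc 1 ⌊x⌋₊, ∫ v in (0 : ℝ)..Real.log x,
          w m * Set.indicator (Set.Ici (Real.log m)) g v := by
        refine Finset.sum_congr rfl fun m hm => ?_
        obtain ⟨hm1, hmx⟩ := mem_Icc.mp hm
        have hm0 : (0 : ℝ) < m := by exact_mod_cast hm1
        have hmx' : (m : ℝ) ≤ x := (Nat.le_floor_iff hx0.le).mp hmx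
        rw [intervalIntegral.integral_const_mul,
          integral_indicator_Ici (Real.log_nonneg (by exact_mod_cast hm1))
            (Real.log_le_log hm0 hmx')]
    _ = ∫ v in (0 : ℝ)..Real.log x, ∑ m ∈ Icc 1 ⌊x⌋₊,
          w m * Set.indicator (Set.Ici (Real.log m)) g v := by
        rw [intervalIntegral.integral_finsetSum]
        exact fun m _ => (intervalIntegrable_indicator_Ici (hg _ _) _).const_mul _
    _ = ∫ v in (0 : ℝ)..Real.log x, (∑ m ∈ Icc 1 ⌊Real.exp v⌋₊, w m) * g v := by
        refine intervalIntegral.integral_congr fun v hv => ?_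
        rw [Set.uIcc_of_le hlogx] at hv
        have hvx : Real.exp v ≤ x := by
          simpa [Real.exp_log hx0] using Real.exp_le_exp.mpr hv.2
        rw [Finset.sum_mul]
        exact sum_indicator_Ici_log (g := fun _ => g) hvx

/-- Reordering a Dirichlet convolution under a cut-off:
`Σ_{1 ≤ n ≤ D} Σ_{lm = n} φ(l,m) = Σ_{1 ≤ m ≤ D} Σ_{1 ≤ l ≤ D/m} φ(l,m)`.
(Adapted from the line skeleton's `sum_Icc_sum_divisorsAntidiagonal`.) -/
theorem sum_Icc_sum_divisorsAntidiagonal' (φ : ℕ → ℕ → ℝ) (D : ℕ) :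
    ∑ n ∈ Icc 1 D, ∑ p ∈ n.divisorsAntidiagonal, φ p.1 p.2 =
      ∑ m ∈ Icc 1 D, ∑ l ∈ Icc 1 (D / m), φ l m := by
  rw [Finset.sum_sigma', Finset.sum_sigma']
  refine Finset.sum_bij' (fun x _ => ⟨x.2.2, x.2.1⟩) (fun y _ => ⟨y.2 * y.1, (y.2, y.1)⟩)
    ?_ ?_ ?_ (fun _ _ => rfl) (fun _ _ => rfl)
  · rintro ⟨n, ⟨l, m⟩⟩ hx
    simp only [Finset.mem_sigma, mem_Icc, Nat.mem_divisorsAntidiagonal] at hx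
    obtain ⟨⟨_, hnD⟩, hlm, hn0⟩ := hx
    subst hlm
    have hm : 0 < m := Nat.pos_of_ne_zero fun h => hn0 (by simp [h])
    have hl : 0 < l := Nat.pos_of_ne_zero fun h => hn0 (by simp [h])
    exact Finset.mem_sigma.mpr ⟨mem_Icc.mpr ⟨hm, le_trans (Nat.le_mul_of_pos_left m hl) hnD⟩,
      mem_Icc.mpr ⟨hl, (Nat.le_div_iff_mul_le hm).mpr hnD⟩⟩
  · rintro ⟨m, l⟩ hy
    simp only [Finset.mem_sigma, mem_Icc] at hy
    obtain ⟨⟨hm1, hmD⟩, hl1, hlD⟩ := hy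
    have hlm : l * m ≤ D := (Nat.le_div_iff_mul_le hm1).mp hlD
    have hne : l * m ≠ 0 := Nat.mul_ne_zero (by omega) (by omega)
    exact Finset.mem_sigma.mpr ⟨mem_Icc.mpr ⟨Nat.one_le_iff_ne_zero.mpr hne, hlm⟩,
      Nat.mem_divisorsAntidiagonal.mpr ⟨rfl, hne⟩⟩
  · rintro ⟨n, ⟨l, m⟩⟩ hx
    simp only [Finset.mem_sigma, mem_Icc, Nat.mem_divisorsAntidiagonal] at hx
    obtain ⟨_, hlm, _⟩ := hx
    simp [hlm]

/-- **(ii)** The Riesz mean of a Dirichlet product, reordered over the second factor: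
`R⁽ʲ⁾_{B*α}(x) = Σ_{m ≤ x} α(m)/m · R⁽ʲ⁾_B(x/m)`. -/
theorem riesz_mul_eq (B α : ArithmeticFunction ℝ) (j : ℕ) (x : ℝ) :
    ∑ n ∈ Icc 1 ⌊x⌋₊, (B * α) n / n * Real.log (x / n) ^ j =
      ∑ m ∈ Icc 1 ⌊x⌋₊, α m / m *
        ∑ l ∈ Icc 1 ⌊x / m⌋₊, B l / l * Real.log (x / m / l) ^ j := by
  calc ∑ n ∈ Icc 1 ⌊x⌋₊, (B * α) n / n * Real.log (x / n) ^ j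
      = ∑ n ∈ Icc 1 ⌊x⌋₊, ∑ p ∈ n.divisorsAntidiagonal,
          α p.2 / p.2 * (B p.1 / p.1 * Real.log (x / p.2 / p.1) ^ j) := by
        refine Finset.sum_congr rfl fun n _ => ?_
        rw [ArithmeticFunction.mul_apply, Finset.sum_div, Finset.sum_mul]
        refine Finset.sum_congr rfl fun p hp => ?_
        obtain ⟨hpn, hn0⟩ := Nat.mem_divisorsAntidiagonal.mp hp
        have h1 : (p.1 : ℝ) ≠ 0 := by exact_mod_cast (Nat.mul_ne_zero_iff.mp (hpn ▸ hn0)).1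
        have h2 : (p.2 : ℝ) ≠ 0 := by exact_mod_cast (Nat.mul_ne_zero_iff.mp (hpn ▸ hn0)).2
        rw [← hpn, Nat.cast_mul, div_div, mul_comm (p.2 : ℝ)]
        field_simp
    _ = ∑ m ∈ Icc 1 ⌊x⌋₊, ∑ l ∈ Icc 1 (⌊x⌋₊ / m),
          α m / m * (B l / l * Real.log (x / m / l) ^ j) :=
        sum_Icc_sum_divisorsAntidiagonal'
          (fun l m => α m / m * (B l / l * Real.log (x / m / l) ^ j)) ⌊x⌋₊
    _ = ∑ m ∈ Icc 1 ⌊x⌋₊, α m / m *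
          ∑ l ∈ Icc 1 ⌊x / m⌋₊, B l / l * Real.log (x / m / l) ^ j := by
        refine Finset.sum_congr rfl fun m _ => ?_
        rw [← Finset.mul_sum, Nat.floor_div_natCast]

/-- A convergent order-`k` Riesz mean of an arithmetic function is bounded on `ℝ`
(pattern of the line skeleton's `exists_bound_of_tendsto_rieszMean`). -/
theorem exists_bound_of_tendsto_rieszMean' (B : ℕ → ℝ) (k : ℕ) {M : ℝ}
    (hG : Tendsto (fun y : ℝ => ∑ l ∈ Icc 1 ⌊y⌋₊, B l / l * Real.log (y / l) ^ k) atTop (𝓝 M)) :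
    ∃ K : ℝ, ∀ y : ℝ, |∑ l ∈ Icc 1 ⌊y⌋₊, B l / l * Real.log (y / l) ^ k| ≤ K := by
  obtain ⟨Y, hY⟩ := ((hG.abs.eventually_lt_const (lt_add_one |M|)).and
    (eventually_ge_atTop 1)).exists_forall_of_atTop
  have hY1 : 1 ≤ Y := (hY Y le_rfl).2
  have hlogY : 0 ≤ Real.log Y := Real.log_nonneg hY1
  refine ⟨max (|M| + 1) ((∑ l ∈ Icc 1 ⌊Y⌋₊, |B l| / l) * Real.log Y ^ k), fun y => ?_⟩
  rcases le_or_gt Y y with hy | hy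
  · exact (hY y hy).1.le.trans (le_max_left _ _)
  rcases lt_or_ge y 1 with hy1 | hy1
  · rw [Nat.floor_eq_zero.mpr hy1]
    exact le_max_of_le_left (by simp; positivity)
  refine le_trans ?_ (le_max_right _ _)
  rw [Finset.sum_mul]
  refine (Finset.abs_sum_le_sum_abs _ _).trans ((Finset.sum_le_sum fun l hl => ?_).trans
    (Finset.sum_le_sum_of_subset_of_nonneg
      (Finset.Icc_subset_Icc_right (Nat.floor_le_floor hy.le)) fun l _ _ => by positivity))
  obtain ⟨hl1, hly⟩ := mem_Icc.mp hl
  have hl0 : (0 : ℝ) < l := by exact_mod_cast hl1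
  have hly' : (l : ℝ) ≤ y := (Nat.le_floor_iff (by linarith)).mp hly
  have hlog0 : 0 ≤ Real.log (y / l) := Real.log_nonneg ((one_le_div hl0).mpr hly')
  have hlogle : Real.log (y / l) ≤ Real.log Y := Real.log_le_log (by positivity)
    ((div_le_self (by linarith) (by exact_mod_cast hl1)).trans hy.le)
  rw [abs_mul, abs_div, Nat.abs_cast, abs_pow, abs_of_nonneg hlog0]
  exact mul_le_mul_of_nonneg_left (pow_le_pow_left₀ hlog0 hlogle k) (by positivity)

/-- **(iii)** From the sharp cut-off decay `|M_α(x)| ≤ C/log² x` (`x ≥ 2`) to a global bound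
`|M_α(e^v)| ≤ D/(1+v²)` for `v ≥ 0` (on `[1,2)` the sum is the constant `α 1`). -/
theorem abs_sum_exp_le {α : ℕ → ℝ} {C : ℝ}
    (hC : ∀ x : ℝ, 2 ≤ x → |∑ n ∈ Icc 1 ⌊x⌋₊, α n / n| ≤ C / Real.log x ^ 2)
    {v : ℝ} (hv : 0 ≤ v) :
    |∑ n ∈ Icc 1 ⌊Real.exp v⌋₊, α n / n| ≤ (5 * C + 2 * |α 1|) * (1 + v ^ 2)⁻¹ := by
  have hC0 : 0 ≤ C := by
    have h := (abs_nonneg _).trans (hC 2 le_rfl)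
    rw [le_div_iff₀ (by positivity), zero_mul] at h
    exact h
  have h2 : Real.exp (Real.log 2) = 2 := Real.exp_log two_pos
  rcases le_or_gt (Real.log 2) v with h2v | h2v
  · have h := hC _ (h2 ▸ Real.exp_le_exp.mpr h2v)
    rw [Real.log_exp] at h
    refine h.trans ?_
    have hv0 : 1 / 2 < v := by linarith [Real.log_two_gt_d9]
    rw [← div_eq_mul_inv, div_le_div_iff₀ (by positivity) (by positivity)]
    nlinarith [mul_nonneg hC0 (show (0 : ℝ) ≤ 4 * v ^ 2 - 1 by nlinarith),
      mul_nonneg (abs_nonneg (α 1)) (sq_nonneg v)]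
  · have hfl : ⌊Real.exp v⌋₊ = 1 := by
      rw [Nat.floor_eq_iff (Real.exp_pos v).le, Nat.cast_one]
      exact ⟨by simpa using Real.one_le_exp hv, by linarith [h2 ▸ Real.exp_lt_exp.mpr h2v]⟩
    rw [hfl, Finset.Icc_self, Finset.sum_singleton, Nat.cast_one, div_one, ← div_eq_mul_inv,
      le_div_iff₀ (by positivity)]
    nlinarith [abs_nonneg (α 1), mul_nonneg hC0 (sq_nonneg v),
      show v ^ 2 < 1 by nlinarith [Real.log_two_lt_d9]]

/-- **The deep integral tends to `0`** (dominated convergence on `(0, ∞)`): if `|M(e^v)| ≤ D/(1+v²)`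
for `v ≥ 0`, `δ` is bounded and `δ → 0` at `+∞`, then `∫₀^{log x} M(e^v) δ(x/e^v) dv → 0`. -/
theorem tendsto_integral_mul_of_decay {M δ : ℝ → ℝ} {K D : ℝ}
    (hMm : Measurable M) (hδm : Measurable δ)
    (hMb : ∀ v, 0 ≤ v → |M (Real.exp v)| ≤ D * (1 + v ^ 2)⁻¹)
    (hδK : ∀ y, |δ y| ≤ K) (hδ0 : Tendsto δ atTop (𝓝 0)) :
    Tendsto (fun x : ℝ => ∫ v in (0 : ℝ)..Real.log x, M (Real.exp v) * δ (x / Real.exp v))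
      atTop (𝓝 0) := by
  have key : Tendsto (fun x : ℝ => ∫ v in Set.Ioi (0 : ℝ),
      Set.indicator (Set.Iic (Real.log x)) (fun v => M (Real.exp v) * δ (x / Real.exp v)) v)
      atTop (𝓝 (∫ _ in Set.Ioi (0 : ℝ), (0 : ℝ))) := by
    refine tendsto_integral_filter_of_dominated_convergence (fun v => D * (1 + v ^ 2)⁻¹ * K)
      (Eventually.of_forall fun x => ?_) (Eventually.of_forall fun x => ?_) ?_ ?_
    · exact (((hMm.comp Real.measurable_exp).mul
        (hδm.comp (measurable_const.div Real.measurable_exp))).indicator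
          measurableSet_Iic).aestronglyMeasurable
    · rw [ae_restrict_iff' measurableSet_Ioi]
      refine Eventually.of_forall fun v (hv : 0 < v) => ?_
      refine (norm_indicator_le_norm_self _ _).trans ?_
      rw [Real.norm_eq_abs, abs_mul]
      exact mul_le_mul (hMb v hv.le) (hδK _) (abs_nonneg _) ((abs_nonneg _).trans (hMb v hv.le))
    · exact ((integrable_inv_one_add_sq.const_mul D).mul_const K).integrableOn
    · refine Eventually.of_forall fun v => ?_
      have h1 : Tendsto (fun x : ℝ => M (Real.exp v) * δ (x / Real.exp v)) atTop (𝓝 0) := by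
        have := (hδ0.comp (tendsto_id.atTop_div_const (Real.exp_pos v))).const_mul
          (M (Real.exp v))
        simpa using this
      refine h1.congr' ?_
      filter_upwards [eventually_ge_atTop (Real.exp v)] with x hx
      rw [Set.indicator_of_mem]
      exact (Real.le_log_iff_exp_le ((Real.exp_pos v).trans_le hx)).mpr hx
  rw [integral_zero] at key
  refine key.congr' ?_
  filter_upwards [eventually_ge_atTop 1] with x hx
  rw [setIntegral_indicator measurableSet_Iic, Set.Ioi_inter_Iic,
    intervalIntegral.integral_of_le (Real.log_nonneg hx)]

/-- **(iv) The induction step.**  If `R⁽ᵏ⁾_B → L`, `R⁽¹⁾_α → Lα` and `|M_α(x)| ≤ C/log² x`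
(`x ≥ 2`), then `R⁽ᵏ⁺¹⁾_{B*α} → (k+1)·L·Lα`. -/
theorem tendsto_riesz_mul (B α : ArithmeticFunction ℝ) (k : ℕ) {L Lα C : ℝ}
    (hB : Tendsto (fun y : ℝ => ∑ n ∈ Icc 1 ⌊y⌋₊, B n / n * Real.log (y / n) ^ k) atTop (𝓝 L))
    (hα1 : Tendsto (fun x : ℝ => ∑ n ∈ Icc 1 ⌊x⌋₊, α n / n * Real.log (x / n)) atTop (𝓝 Lα))
    (hα2 : ∀ x : ℝ, 2 ≤ x → |∑ n ∈ Icc 1 ⌊x⌋₊, α n / n| ≤ C / Real.log x ^ 2) :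
    Tendsto (fun x : ℝ => ∑ n ∈ Icc 1 ⌊x⌋₊, (B * α) n / n * Real.log (x / n) ^ (k + 1))
      atTop (𝓝 ((k + 1) * (L * Lα))) := by
  -- `δ := R⁽ᵏ⁾_B − L` and `M := M_α`, as opaque functions with defining equations
  obtain ⟨δ, hδ⟩ : ∃ δ : ℝ → ℝ, ∀ y,
      δ y = (∑ n ∈ Icc 1 ⌊y⌋₊, B n / n * Real.log (y / n) ^ k) - L := ⟨_, fun _ => rfl⟩
  obtain ⟨M, hM⟩ : ∃ M : ℝ → ℝ, ∀ t, M t = ∑ n ∈ Icc 1 ⌊t⌋₊, α n / n := ⟨_, fun _ => rfl⟩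
  obtain ⟨K, hK⟩ := exists_bound_of_tendsto_rieszMean' B k hB
  have hδm : Measurable δ := by
    rw [show δ = fun y => (∑ n ∈ Icc 1 ⌊y⌋₊, B n / n * Real.log (y / n) ^ k) - L from funext hδ]
    exact (measurable_sum_Icc_floor (F := fun n y => B n / n * Real.log (y / n) ^ k)
      fun n => by fun_prop).sub measurable_const
  have hδK : ∀ y, |δ y| ≤ K + |L| := fun y => by
    rw [hδ]
    exact (abs_sub _ _).trans (add_le_add (hK y) le_rfl)
  have hδ0 : Tendsto δ atTop (𝓝 0) := by
    have h := hB.sub_const L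
    rw [sub_self] at h
    exact h.congr fun y => (hδ y).symm
  have hMm : Measurable M := by
    rw [show M = fun t => ∑ n ∈ Icc 1 ⌊t⌋₊, α n / n from funext hM]
    exact measurable_sum_Icc_floor fun n => measurable_const
  have hMb : ∀ v, 0 ≤ v → |M (Real.exp v)| ≤ (5 * C + 2 * |α 1|) * (1 + v ^ 2)⁻¹ :=
    fun v hv => by rw [hM]; exact abs_sum_exp_le hα2 hv
  have hI := tendsto_integral_mul_of_decay hMm hδm hMb hδK hδ0
  -- the identity for `x ≥ 1`
  have hid : ∀ x : ℝ, 1 ≤ x →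
      ∑ n ∈ Icc 1 ⌊x⌋₊, (B * α) n / n * Real.log (x / n) ^ (k + 1) =
        (k + 1) * (L * ∑ m ∈ Icc 1 ⌊x⌋₊, α m / m * Real.log (x / m) +
          ∫ v in (0 : ℝ)..Real.log x, M (Real.exp v) * δ (x / Real.exp v)) := by
    intro x hx
    have hx0 : 0 < x := one_pos.trans_le hx
    have hg : ∀ a b, IntervalIntegrable (fun v => δ (x / Real.exp v)) volume a b :=
      intervalIntegrable_of_abs_le (hδm.comp (measurable_const.div Real.measurable_exp))
        fun v => hδK _
    have hswap := sum_mul_integral_log_eq (w := fun m => α m / m) hg hx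
    simp_rw [← hM] at hswap
    rw [← hswap, riesz_mul_eq, mul_add, Finset.mul_sum, Finset.mul_sum, Finset.mul_sum,
      ← Finset.sum_add_distrib]
    refine Finset.sum_congr rfl fun m hm => ?_
    obtain ⟨hm1, hmx⟩ := mem_Icc.mp hm
    have hm0 : (0 : ℝ) < m := by exact_mod_cast hm1
    have hmx' : (m : ℝ) ≤ x := (Nat.le_floor_iff hx0.le).mp hmx
    have hxm : 1 ≤ x / m := (one_le_div hm0).mpr hmx'
    rw [riesz_succ_eq_integral (⇑B) k hxm]
    have hcongr : ∫ u in (0 : ℝ)..Real.log (x / m),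
          ∑ n ∈ Icc 1 ⌊Real.exp u⌋₊, B n / n * Real.log (Real.exp u / n) ^ k
        = ∫ u in (0 : ℝ)..Real.log (x / m), (δ (Real.exp u) + L) :=
      intervalIntegral.integral_congr fun u _ => by simp only [hδ]; ring
    have hδi : IntervalIntegrable (fun u => δ (Real.exp u)) volume 0 (Real.log (x / m)) :=
      intervalIntegrable_of_abs_le (hδm.comp Real.measurable_exp) (fun v => hδK _) _ _
    have hsub : ∫ u in (0 : ℝ)..Real.log (x / m), δ (Real.exp u) =
        ∫ v in Real.log m..Real.log x, δ (x / Real.exp v) := by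
      rw [Real.log_div hx0.ne' hm0.ne']
      have h2 : (fun v => δ (x / Real.exp v)) = fun v => δ (Real.exp (Real.log x - v)) := by
        funext v
        rw [Real.exp_sub, Real.exp_log hx0]
      rw [h2, intervalIntegral.integral_comp_sub_left (fun u => δ (Real.exp u)) (Real.log x),
        sub_self]
    rw [hcongr, intervalIntegral.integral_add hδi intervalIntegrable_const,
      intervalIntegral.integral_const, hsub, smul_eq_mul, sub_zero]
    ring
  have hlim : Tendsto (fun x : ℝ => (k + 1 : ℝ) *
      (L * ∑ m ∈ Icc 1 ⌊x⌋₊, α m / m * Real.log (x / m) +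
        ∫ v in (0 : ℝ)..Real.log x, M (Real.exp v) * δ (x / Real.exp v))) atTop
      (𝓝 ((k + 1) * (L * Lα + 0))) :=
    ((hα1.const_mul L).add hI).const_mul _
  rw [add_zero] at hlim
  refine hlim.congr' ?_
  filter_upwards [eventually_ge_atTop 1] with x hx
  exact (hid x hx).symm

end RieszProductLimit

open RieszProductLimit in
/-- **S2b₂α — RieszProductLimit.**  Order-1 log-Riesz limits (H1) and sharp cut-off decay
`C/log² x` (H2) for each factor imply that the order-`k` log-Riesz mean of the `k`-fold Dirichlet
product converges.  Induction on `k`: base `k = 0` (Dirichlet unit, the mean is `1` for `x ≥ 1`);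
step `tendsto_riesz_mul` with `Fin.prod_univ_castSucc`. -/
theorem stub_rieszProductLimit :
    ∀ (k : ℕ) (a : Fin k → ArithmeticFunction ℝ),
      (∀ i, ∃ L : ℝ, Tendsto (fun x : ℝ => ∑ n ∈ Icc 1 ⌊x⌋₊, a i n / n * Real.log (x / n))
        atTop (𝓝 L)) →
      (∀ i, ∃ C : ℝ, ∀ x : ℝ, 2 ≤ x → |∑ n ∈ Icc 1 ⌊x⌋₊, a i n / n| ≤ C / Real.log x ^ 2) →
      ∃ M : ℝ, Tendsto (fun x : ℝ => ∑ n ∈ Icc 1 ⌊x⌋₊, (∏ i, a i) n / n * Real.log (x / n) ^ k)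
        atTop (𝓝 M) := by
  intro k
  induction k with
  | zero =>
    intro a _ _
    refine ⟨1, tendsto_const_nhds.congr' ?_⟩
    filter_upwards [eventually_ge_atTop 1] with x hx
    have h1 : 1 ∈ Icc 1 ⌊x⌋₊ := mem_Icc.mpr ⟨le_rfl, Nat.le_floor (by simpa using hx)⟩
    rw [Fin.prod_univ_zero, Finset.sum_eq_single_of_mem 1 h1 (fun n _ hn1 => by
      rw [ArithmeticFunction.one_apply_ne hn1, zero_div, zero_mul])]
    simp
  | succ k ih =>
    intro a h1 h2
    obtain ⟨L, hL⟩ := ih (fun i => a i.castSucc) (fun i => h1 i.castSucc) (fun i => h2 i.castSucc)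
    obtain ⟨Lα, hLα⟩ := h1 (Fin.last k)
    obtain ⟨C, hC⟩ := h2 (Fin.last k)
    refine ⟨(k + 1) * (L * Lα), ?_⟩
    simp only [Fin.prod_univ_castSucc]
    exact tendsto_riesz_mul _ _ k hL hLα hC

end Summit.Parity.BatemanHorn.Cruxes.RoughValueLaw.FriableDeepTail
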